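import Literature.Analysis.OperatorTheory.Enflo2023.Basic
import HarnessLib

/-!
# Enflo 2023, v2 pp.6–7: the Type 1 / Type 2 dichotomy, and the claimed statement `ISP_separable`

Source under adjudication: Per H. Enflo, *On the invariant subspace problem in Hilbert spaces*, arXiv:2305.15442 (v1
2023, v2 2024), bib key `Enflo2023` — a CLAIMED proof of the invariant subspace problem for operators on a separable
Hilbert space.  This file is part of the kernel-tight typing of the manuscript by the b2b-enflo repair cell (the
REFEREE seat's independent record, unit b2b-enflo-3).  NOTHING here asserts that the manuscript's main theorem holds:
`ISP_separable` is STATED (tagged `@[claim "Enflo2023" "disputed"]`) and no declaration in the tree proves it.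
Value (BLOCK-2b): theorems / refutations of typed inferences about a text — not progress on the problem.

The paper splits the operators under consideration into "Type 1" and "Type 2" (v2 pp.6–7) and treats the two classes
separately.  Both definitions are recorded verbatim (with `⟨y/‖y‖, u₀⟩ ≥ 1/100` read as a condition on the real part,
the only reading under which the inequality makes sense, and with the implicit `y ≠ 0`), and the two classes are
checked to be exhaustive and disjoint — a step the paper uses without comment ("For every operator of type 1 … For
operators of type 2 …", v2 p.7).  `T^j x` is written `(⇑T)^[j] x` (function iterate) here, as in the referee record;
`(T ^ j) x` (operator power, as in `Basic.lean`) is the same vector (`ContinuousLinearMap.coe_pow`).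
STATUS: CLOSED (zero sorry); axioms `[propext, Classical.choice, Quot.sound]`.
Origin: referee-b2b-enflo-3-0 (2026-08-18), staged from the cell package `EnfloISP/Referee/{Types,Basic}.lean`
unchanged except for the namespace, the target predicate (`Basic.lean`'s `HasNontrivialClosedInvariantSubspace`
replaces the referee's `HasNIS`) and the provenance tags.
-/

open scoped InnerProductSpace

namespace Literature.Analysis.OperatorTheory.Enflo2023.Referee

variable {H : Type*} [NormedAddCommGroup H] [InnerProductSpace ℂ H]

/-- The statement the paper claims (v2 p.1, abstract): the Invariant Subspace Problem for separable
infinite-dimensional complex Hilbert spaces.  Stated only; nothing in the tree proves it. -/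
@[claim "Enflo2023" "disputed"]
def ISP_separable : Prop :=
  ∀ (H : Type) [NormedAddCommGroup H] [InnerProductSpace ℂ H] [CompleteSpace H]
    [TopologicalSpace.SeparableSpace H], ¬ FiniteDimensional ℂ H →
    ∀ T : H →L[ℂ] H, HasNontrivialClosedInvariantSubspace T

/-- The angular condition `⟨y/‖y‖, u₀⟩ ≥ 1/100` of the paper (which presupposes `y ≠ 0`; without
that clause the `y = 0` witness would make every operator of Type 2). [cite: Enflo2023, v2 p.6] -/
def AngleCond (u0 y : H) : Prop := y ≠ 0 ∧ (1 / 100 : ℝ) * ‖y‖ ≤ (⟪u0, y⟫_ℂ).re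

/-- Paper p. 6: `T` is of Type 1 if there is a unit vector `u₀` such that for every `n ≥ 1` there
is `δₙ > 0` such that every `y` with `⟨y/‖y‖, u₀⟩ ≥ 1/100` has some `j ≥ n` with
`|⟨T^j y, y⟩| ≥ δₙ ‖y‖²`. [cite: Enflo2023, v2 p.6] -/
def Type1 (T : H →L[ℂ] H) : Prop :=
  ∃ u0 : H, ‖u0‖ = 1 ∧ ∀ n : ℕ, 1 ≤ n → ∃ δ : ℝ, 0 < δ ∧
    ∀ y : H, AngleCond u0 y → ∃ j : ℕ, n ≤ j ∧ δ * ‖y‖ ^ 2 ≤ ‖⟪(⇑T)^[j] y, y⟫_ℂ‖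

/-- Paper p. 7: `T` is of Type 2 if for every unit vector `u₀` there is `m ≥ 1` such that for every
`δ > 0` there is `y` with `⟨y/‖y‖, u₀⟩ ≥ 1/100` and `|⟨T^j y, y⟩| ≤ δ ‖y‖²` for every `j ≥ m`. [cite: Enflo2023, v2 p.7] -/
def Type2 (T : H →L[ℂ] H) : Prop :=
  ∀ u0 : H, ‖u0‖ = 1 → ∃ m : ℕ, 1 ≤ m ∧ ∀ δ : ℝ, 0 < δ →
    ∃ y : H, AngleCond u0 y ∧ ∀ j : ℕ, m ≤ j → ‖⟪(⇑T)^[j] y, y⟫_ℂ‖ ≤ δ * ‖y‖ ^ 2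

/-- The two classes are exhaustive (used tacitly on p. 7: "For every operator of type 1 … For
operators of type 2 …"). [cite: Enflo2023, v2 p.7] -/
theorem type1_or_type2 (T : H →L[ℂ] H) : Type1 T ∨ Type2 T := by
  by_cases h : Type1 T
  · exact Or.inl h
  · right
    unfold Type1 at h
    push Not at h
    intro u0 hu0
    obtain ⟨n, hn, hδ⟩ := h u0 hu0
    refine ⟨n, hn, fun δ hδpos => ?_⟩
    obtain ⟨y, hy, hj⟩ := hδ δ hδpos
    exact ⟨y, hy, fun j hj' => (hj j hj').le⟩

/-- The two classes are disjoint (so the case split is a genuine dichotomy). [cite: Enflo2023, v2 p.7] -/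
theorem not_type1_and_type2 (T : H →L[ℂ] H) : ¬ (Type1 T ∧ Type2 T) := by
  rintro ⟨⟨u0, hu0, h1⟩, h2⟩
  obtain ⟨m, hm, h2'⟩ := h2 u0 hu0
  obtain ⟨δ, hδ, h1'⟩ := h1 m hm
  obtain ⟨y, hy, hle⟩ := h2' (δ / 2) (by linarith)
  obtain ⟨j, hj, hge⟩ := h1' y hy
  have hy0 : 0 < ‖y‖ := norm_pos_iff.2 hy.1
  have := hle j hj
  nlinarith [sq_pos_of_pos hy0]

end Literature.Analysis.OperatorTheory.Enflo2023.Referee
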